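import Literature.NumberTheory.Rogawski1990.CMThetaDockingClausesTest   -- ★ p840296 the UNRESTRICTED Test edition `CMThetaDockingClausesTest` (binder block + body copied BYTE-IDENTICALLY below, two hypotheses inserted)
import HarnessLib


/-!
# The theta-docking clause ON TEST FUNCTIONS, RESTRICTED TO THE WEIGHT-ONE AUTOMORPHIC LOCUS («W1»): `CMThetaDockingClausesTestW1` (statement only)

Topic `NumberTheory/Rogawski1990`; namespace `Literature.NumberTheory.Rogawski1990`.  ONE DEFINITION WITH BODY + its `Iff.rfl` unfolding + the monotonicity one-liner from the
unrestricted ★ `CMThetaDockingClausesTest`; no named fact (net debt 0), no instance, no notation, no `sorry`; ★ `CMThetaDockingClausesTest` is NOT edited (supersede-not-edit).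
Cell `pub/hodgecm-mathlib` (D-0151), crux H413 = `stmt-HodgeConjecture-24833`; ROAD W of the LH10 line (LH10-p02 (g0) 2026-09-02T03:19:42Z architectural ask; F0P2-p06 (g14)
census 03:24:26Z; F0P2-ref1 (g10) r363∕r364 «CONDITIONAL GO on the P2 side», item (a)).

WHAT.  ★ `CMThetaDockingClausesTest L H Δ mH mG νH νG ξ μω ξloc e₁ dV hdV hdV0 g hg` (p840296) quantifies over EVERY pair `(μ, χ_f)` on letter #76's two dictionary equations.
Its only consumer in the h413 cone eliminates that `∀` at the DICT-CHOICE witness `(grdMu ξ, grdChi ξ)` of `ξ` (★ `F0P2oD7alphaMembersThetaClassTest` :143, fed from ★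
`F0P2vPKPiOfTokens.pkPi_of_tokens` :208–:221; skeleton `F0_P2PKPiRung4.lean` :897 → :936), where `hw : HasWeight L grdMu 1` and `haut : IsAutomorphicOneChar … grdChi` are in
scope (★ `F0P2iRIGinfDischarge` :180).  This twin is the SAME text with the two hypotheses
`HasWeight L μ 1 →` (★ `ConjugateSelfDualCharacters.HasWeight`: weight one at every infinite place) and
`IsAutomorphicOneChar (↥(maximalRealSubfield L)) L (IsCMField.complexConj L) χf →` (★ [Liu2021 Def. 4.11]: `χ_f` trivial on the rational norm-one units)
inserted immediately after the unit-norm hypothesis — print's theta-docking clause [Rogawski1990 Prop. 13.1.3 (d), 13.1.4; GelbartRogawski1991 Lem. 5.1.2] RESTRICTED to the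
weight-one automorphic locus (the only locus HC_CM instantiates); in-house road LH10-p02 ‹O1♭″› (theta engine ★ `thetaOccursInGen` + (WAᴸ) + (SCᴸ) + O2).  The GR91∕R90
cites are the ENCLOSING printed statements; W1 is WEAKER (`cmThetaDockingClausesTest_toW1`).
* `CMThetaDockingClausesTestW1` + `cmThetaDockingClausesTestW1_iff` (`Iff.rfl`) + `cmThetaDockingClausesTest_toW1` (monotonicity: the unrestricted clause implies the W1 clause).
HONEST SCOPE.  Definitions and one-line logic; HC_CM is proved only modulo the printed citations (2 remaining named inputs hLiu418, h413) until rung 0 closes; this file proves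
no printed statement.

## References
* [Rogawski1990] J. D. Rogawski, Ann. of Math. Stud. 123 (1990): §13.1 Prop. 13.1.3 (d), Prop. 13.1.4 p. 199; §12.2 (2) p. 174.
* [GelbartRogawski1991] S. Gelbart, J. Rogawski, Invent. Math. 105 (1991): Lem. 5.1.2 p. 466; §1.4 pp. 450–451.
* [Liu2021] Y. Liu, Invent. Math. 225 (2021): Def. 4.11, Prop. 4.13.
-/


noncomputable section

open NumberField IsDedekindDomain MeasureTheory
open scoped Matrix ComplexOrder

namespace Literature.NumberTheory.Rogawski1990

open Literature.NumberTheory Literature.NumberTheory.Automorphic Literature.NumberTheory.Automorphic.UnitaryGroup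
open Literature.NumberTheory.Automorphic.IdeleClassGroup
open Literature.NumberTheory.Automorphic.Liu2021 Literature.NumberTheory.Automorphic.Liu2021.Def411WeilCarriers
open Literature.NumberTheory.GaloisRepresentations
open Literature.NumberTheory.GelbartRogawski1991

section Clauses

variable (L : Type) [Field L] [NumberField L] [IsCMField L] (H : Matrix (Fin 3) (Fin 3) L)
  (hH : (H.map (cmConjRingHom L))ᵀ = H) (hHd : IsUnit H.det)

/-- **The theta-docking clause ON TEST FUNCTIONS, RESTRICTED TO THE WEIGHT-ONE AUTOMORPHIC LOCUS (W1)** — ★ `CMThetaDockingClausesTest`'s text VERBATIM with the two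
hypotheses `HasWeight L μ 1 →` and `IsAutomorphicOneChar (↥(maximalRealSubfield L)) L (IsCMField.complexConj L) χf →` inserted after the unit-norm hypothesis: for every
DICT-tied pair `(μ, χ_f)` WITH `μ` OF WEIGHT ONE AND `χ_f` AUTOMORPHIC, at every non-split finite `v`, every form congruence, every Haar `μZ`, every Keys-labelled `(π², πⁿ)`
with `πⁿ` not square-integrable, every SUPERCUSPIDAL `πs ≠ πⁿ ∘ e` completing `πⁿ ∘ e` in the identity (13.1.4) ON TEST FUNCTIONS is the local theta type
`X_v(μ, ε, χ_f) ∘ κ_v⁻¹` for some line class `ε`.  Print's clause [Rogawski1990 Prop. 13.1.3 (d), 13.1.4; GelbartRogawski1991 Lem. 5.1.2] RESTRICTED to the weight-one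
automorphic locus (the only locus HC_CM instantiates: ★ `pkPi_of_tokens` :208–:221 ∕ skeleton :936); in-house road LH10-p02 ‹O1♭″›.  A PREDICATE, to be asserted only inside
the joint existential of the transfer package, never free-standing.
[cite: Rogawski1990, §13.1 Prop. 13.1.3 (d), Prop. 13.1.4 p. 199; §12.2 (2) p. 174] [cite: GelbartRogawski1991, Lem. 5.1.2 p. 466; §1.4 pp. 450–451] [cite: Liu2021, Def. 4.11, Prop. 4.13] -/
def CMThetaDockingClausesTestW1
    [∀ v : HeightOneSpectrum (𝓞 ↥(maximalRealSubfield L)), MeasurableSpace ((cmDatum L 3 H).Local v)]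
    [∀ v : HeightOneSpectrum (𝓞 ↥(maximalRealSubfield L)),
      MeasurableSpace ((cmDatum L 2 (Matrix.of fun i j : Fin 2 => if i.val + j.val + 1 = 2 then (1 : L) else 0)).Local v ×
        (cmDatum L 1 (Matrix.of fun i j : Fin 1 => if i.val + j.val + 1 = 1 then (1 : L) else 0)).Local v)]
    [∀ (v : HeightOneSpectrum (𝓞 ↥(maximalRealSubfield L)))
        (a : ((cmDatum L 2 (Matrix.of fun i j : Fin 2 => if i.val + j.val + 1 = 2 then (1 : L) else 0)).Local v ×
          (cmDatum L 1 (Matrix.of fun i j : Fin 1 => if i.val + j.val + 1 = 1 then (1 : L) else 0)).Local v)),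
      MeasurableSpace (((cmDatum L 2 (Matrix.of fun i j : Fin 2 => if i.val + j.val + 1 = 2 then (1 : L) else 0)).Local v ×
          (cmDatum L 1 (Matrix.of fun i j : Fin 1 => if i.val + j.val + 1 = 1 then (1 : L) else 0)).Local v) ⧸
        Subgroup.centralizer ({a} : Set ((cmDatum L 2 (Matrix.of fun i j : Fin 2 => if i.val + j.val + 1 = 2 then (1 : L) else 0)).Local v ×
          (cmDatum L 1 (Matrix.of fun i j : Fin 1 => if i.val + j.val + 1 = 1 then (1 : L) else 0)).Local v)))]
    [∀ (v : HeightOneSpectrum (𝓞 ↥(maximalRealSubfield L))) (γ : (cmDatum L 3 H).Local v),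
      MeasurableSpace ((cmDatum L 3 H).Local v ⧸ Subgroup.centralizer ({γ} : Set ((cmDatum L 3 H).Local v)))]
    (Δ : ∀ v : HeightOneSpectrum (𝓞 ↥(maximalRealSubfield L)), LocalTransferFactor L H v)
    (mH : ∀ v : HeightOneSpectrum (𝓞 ↥(maximalRealSubfield L)),
      OrbitalMeasureFamily ((cmDatum L 2 (Matrix.of fun i j : Fin 2 => if i.val + j.val + 1 = 2 then (1 : L) else 0)).Local v ×
        (cmDatum L 1 (Matrix.of fun i j : Fin 1 => if i.val + j.val + 1 = 1 then (1 : L) else 0)).Local v))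
    (mG : ∀ v : HeightOneSpectrum (𝓞 ↥(maximalRealSubfield L)), OrbitalMeasureFamily ((cmDatum L 3 H).Local v))
    (νH : ∀ v : HeightOneSpectrum (𝓞 ↥(maximalRealSubfield L)),
      Measure ((cmDatum L 2 (Matrix.of fun i j : Fin 2 => if i.val + j.val + 1 = 2 then (1 : L) else 0)).Local v ×
        (cmDatum L 1 (Matrix.of fun i j : Fin 1 => if i.val + j.val + 1 = 1 then (1 : L) else 0)).Local v))
    (νG : ∀ v : HeightOneSpectrum (𝓞 ↥(maximalRealSubfield L)), Measure ((cmDatum L 3 H).Local v))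
    (ξ : OneDimAutRepH L) (μω : HeckeCharacter L)
    (ξloc : ∀ v : HeightOneSpectrum (𝓞 ↥(maximalRealSubfield L)),
      (cmDatum L 2 (Matrix.of fun i j : Fin 2 => if i.val + j.val + 1 = 2 then (1 : L) else 0)).Local v ×
        (cmDatum L 1 (Matrix.of fun i j : Fin 1 => if i.val + j.val + 1 = 1 then (1 : L) else 0)).Local v →* ℂˣ)
    {n' : ℕ} (e₁ : Fin 3 × Fin 1 ≃ Fin n') (dV : Fin 3 → L) (hdV : ∀ i, IsCMField.complexConj L (dV i) = dV i) (hdV0 : ∀ i, dV i ≠ 0) (g : GL (Fin 3) L)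
    (hg : ((g : Matrix (Fin 3) (Fin 3) L).map (cmConjRingHom L))ᵀ * H * (g : Matrix (Fin 3) (Fin 3) L) = Matrix.diagonal dV) : Prop :=
  ∀ (μ : Literature.NumberTheory.Automorphic.IdeleClassGroup L →ₜ* Circle) (hμ : IsConjugateSymplectic L μ)
    (χf : UnitaryGroup.finAdelicOne (↥(maximalRealSubfield L)) L (IsCMField.complexConj L) →* ℂˣ),
    Continuous χf → (∀ z, ‖((χf z : ℂˣ) : ℂ)‖ = 1) →
    -- WEIGHT-ONE AUTOMORPHIC LOCUS (W1): `μ` of weight one, `χ_f` automorphic [Liu2021 Def. 4.11, Prop. 4.13] — the only locus HC_CM instantiates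
    HasWeight L μ 1 → IsAutomorphicOneChar (↥(maximalRealSubfield L)) L (IsCMField.complexConj L) χf →
    -- DICTIONARY (μ): `μ̃ = η̃⁻¹ · ψ̃⁻¹ · μω`, semi-locally at every finite place of `L⁺` (verbatim from #76)
    (∀ v : HeightOneSpectrum (𝓞 ↥(maximalRealSubfield L)),
        (toHeckeCharacter L μ).semilocalComponent L v = (ξ.bcη⁻¹ * ξ.bcψ⁻¹ * μω).semilocalComponent L v) →
    -- DICTIONARY (χ_f): `χ_f (z / z̄) = (ψ̃⁻¹ · (η̃⁻¹ ψ̃⁻¹ μω)²) ((1_∞, z))` for every finite idèle `z` of `L` (verbatim from #76)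
    (∀ z : (FiniteAdeleRing (𝓞 L) L)ˣ,
        χf (finAdelicCheck (↥(maximalRealSubfield L)) L (IsCMField.complexConj L)
            (AlgEquiv.ext fun x => by rw [AlgEquiv.mul_apply, IsCMField.complexConj_apply_apply, AlgEquiv.one_apply]) z) =
          (ξ.bcψ⁻¹ * (ξ.bcη⁻¹ * ξ.bcψ⁻¹ * μω) ^ 2)
            (Units.map (N := AdeleRing (𝓞 L) L) (MonoidHom.inr (InfiniteAdeleRing L) (FiniteAdeleRing (𝓞 L) L)) z)) →
    ∀ (v : HeightOneSpectrum (𝓞 ↥(maximalRealSubfield L))),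
      (∀ w : PlacesOver L v, IsCMField.complexConj L • w.1 = w.1) →
      ∀ (T : GL (Fin 3) (LocalRing L v)) (a : LocalRing L v) (ha : IsUnit a)
        (h : formCongr (conjLocal L (IsCMField.complexConj L) v) T (H.map (algebraMap L (LocalRing L v))) =
          a • (Matrix.of fun i j : Fin 3 => if i.val + j.val + 1 = 3 then (1 : L) else 0).map (algebraMap L (LocalRing L v))),
      ∀ [MeasurableSpace (Gqs L v ⧸ Subgroup.center (Gqs L v))] [BorelSpace (Gqs L v ⧸ Subgroup.center (Gqs L v))]
        (μZ : Measure (Gqs L v ⧸ Subgroup.center (Gqs L v))) [μZ.IsHaarMeasure],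
      ∀ (π2 πn : IrrClass (Gqs L v)),
        KeysCaseTwoLabels L v (μω.semilocalComponent L v) (torusLocalComponent L (IsCMField.complexConj L) v ξ.η)
          (torusLocalComponent L (IsCMField.complexConj L) v ξ.ψ) π2 πn →
        ¬ πn.IsSquareIntegrable μZ →
        ∀ (πs : IrrClass ((cmDatum L 3 H).Local v)), πs.IsSupercuspidal →
          πs ≠ IrrClass.comap (cmDatumLocalCongr L v T ha h).symm πn →
          (⟨IrrClass.comap (cmDatumLocalCongr L v T ha h).symm πn, some πs⟩ : CMLocalAPacket L H v).CharIdentityAtTest L H v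
              (fun c f => c.smoothTrace (νG v) f) (ξloc v) (νH v) (Δ v) (mH v) (mG v) →
          ∃ ε : (↥(maximalRealSubfield L))ˣ, ThetaTypeAtCM L H e₁ dV hdV hdV0 g hg μ hμ χf ε v πs

/-- Unfolding of `CMThetaDockingClausesTestW1` (definitional). [cite: Rogawski1990, §13.1 Prop. 13.1.4 p. 199] [cite: GelbartRogawski1991, Lem. 5.1.2 p. 466] -/
theorem cmThetaDockingClausesTestW1_iff
    [∀ v : HeightOneSpectrum (𝓞 ↥(maximalRealSubfield L)), MeasurableSpace ((cmDatum L 3 H).Local v)]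
    [∀ v : HeightOneSpectrum (𝓞 ↥(maximalRealSubfield L)),
      MeasurableSpace ((cmDatum L 2 (Matrix.of fun i j : Fin 2 => if i.val + j.val + 1 = 2 then (1 : L) else 0)).Local v ×
        (cmDatum L 1 (Matrix.of fun i j : Fin 1 => if i.val + j.val + 1 = 1 then (1 : L) else 0)).Local v)]
    [∀ (v : HeightOneSpectrum (𝓞 ↥(maximalRealSubfield L)))
        (a : ((cmDatum L 2 (Matrix.of fun i j : Fin 2 => if i.val + j.val + 1 = 2 then (1 : L) else 0)).Local v ×
          (cmDatum L 1 (Matrix.of fun i j : Fin 1 => if i.val + j.val + 1 = 1 then (1 : L) else 0)).Local v)),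
      MeasurableSpace (((cmDatum L 2 (Matrix.of fun i j : Fin 2 => if i.val + j.val + 1 = 2 then (1 : L) else 0)).Local v ×
          (cmDatum L 1 (Matrix.of fun i j : Fin 1 => if i.val + j.val + 1 = 1 then (1 : L) else 0)).Local v) ⧸
        Subgroup.centralizer ({a} : Set ((cmDatum L 2 (Matrix.of fun i j : Fin 2 => if i.val + j.val + 1 = 2 then (1 : L) else 0)).Local v ×
          (cmDatum L 1 (Matrix.of fun i j : Fin 1 => if i.val + j.val + 1 = 1 then (1 : L) else 0)).Local v)))]
    [∀ (v : HeightOneSpectrum (𝓞 ↥(maximalRealSubfield L))) (γ : (cmDatum L 3 H).Local v),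
      MeasurableSpace ((cmDatum L 3 H).Local v ⧸ Subgroup.centralizer ({γ} : Set ((cmDatum L 3 H).Local v)))]
    (Δ : ∀ v : HeightOneSpectrum (𝓞 ↥(maximalRealSubfield L)), LocalTransferFactor L H v)
    (mH : ∀ v : HeightOneSpectrum (𝓞 ↥(maximalRealSubfield L)),
      OrbitalMeasureFamily ((cmDatum L 2 (Matrix.of fun i j : Fin 2 => if i.val + j.val + 1 = 2 then (1 : L) else 0)).Local v ×
        (cmDatum L 1 (Matrix.of fun i j : Fin 1 => if i.val + j.val + 1 = 1 then (1 : L) else 0)).Local v))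
    (mG : ∀ v : HeightOneSpectrum (𝓞 ↥(maximalRealSubfield L)), OrbitalMeasureFamily ((cmDatum L 3 H).Local v))
    (νH : ∀ v : HeightOneSpectrum (𝓞 ↥(maximalRealSubfield L)),
      Measure ((cmDatum L 2 (Matrix.of fun i j : Fin 2 => if i.val + j.val + 1 = 2 then (1 : L) else 0)).Local v ×
        (cmDatum L 1 (Matrix.of fun i j : Fin 1 => if i.val + j.val + 1 = 1 then (1 : L) else 0)).Local v))
    (νG : ∀ v : HeightOneSpectrum (𝓞 ↥(maximalRealSubfield L)), Measure ((cmDatum L 3 H).Local v))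
    (ξ : OneDimAutRepH L) (μω : HeckeCharacter L)
    (ξloc : ∀ v : HeightOneSpectrum (𝓞 ↥(maximalRealSubfield L)),
      (cmDatum L 2 (Matrix.of fun i j : Fin 2 => if i.val + j.val + 1 = 2 then (1 : L) else 0)).Local v ×
        (cmDatum L 1 (Matrix.of fun i j : Fin 1 => if i.val + j.val + 1 = 1 then (1 : L) else 0)).Local v →* ℂˣ)
    {n' : ℕ} (e₁ : Fin 3 × Fin 1 ≃ Fin n') (dV : Fin 3 → L) (hdV : ∀ i, IsCMField.complexConj L (dV i) = dV i) (hdV0 : ∀ i, dV i ≠ 0) (g : GL (Fin 3) L)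
    (hg : ((g : Matrix (Fin 3) (Fin 3) L).map (cmConjRingHom L))ᵀ * H * (g : Matrix (Fin 3) (Fin 3) L) = Matrix.diagonal dV) :
    CMThetaDockingClausesTestW1 L H Δ mH mG νH νG ξ μω ξloc e₁ dV hdV hdV0 g hg ↔
    (∀ (μ : Literature.NumberTheory.Automorphic.IdeleClassGroup L →ₜ* Circle) (hμ : IsConjugateSymplectic L μ)
    (χf : UnitaryGroup.finAdelicOne (↥(maximalRealSubfield L)) L (IsCMField.complexConj L) →* ℂˣ),
    Continuous χf → (∀ z, ‖((χf z : ℂˣ) : ℂ)‖ = 1) →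
    -- WEIGHT-ONE AUTOMORPHIC LOCUS (W1): `μ` of weight one, `χ_f` automorphic [Liu2021 Def. 4.11, Prop. 4.13] — the only locus HC_CM instantiates
    HasWeight L μ 1 → IsAutomorphicOneChar (↥(maximalRealSubfield L)) L (IsCMField.complexConj L) χf →
    -- DICTIONARY (μ): `μ̃ = η̃⁻¹ · ψ̃⁻¹ · μω`, semi-locally at every finite place of `L⁺` (verbatim from #76)
    (∀ v : HeightOneSpectrum (𝓞 ↥(maximalRealSubfield L)),
        (toHeckeCharacter L μ).semilocalComponent L v = (ξ.bcη⁻¹ * ξ.bcψ⁻¹ * μω).semilocalComponent L v) →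
    -- DICTIONARY (χ_f): `χ_f (z / z̄) = (ψ̃⁻¹ · (η̃⁻¹ ψ̃⁻¹ μω)²) ((1_∞, z))` for every finite idèle `z` of `L` (verbatim from #76)
    (∀ z : (FiniteAdeleRing (𝓞 L) L)ˣ,
        χf (finAdelicCheck (↥(maximalRealSubfield L)) L (IsCMField.complexConj L)
            (AlgEquiv.ext fun x => by rw [AlgEquiv.mul_apply, IsCMField.complexConj_apply_apply, AlgEquiv.one_apply]) z) =
          (ξ.bcψ⁻¹ * (ξ.bcη⁻¹ * ξ.bcψ⁻¹ * μω) ^ 2)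
            (Units.map (N := AdeleRing (𝓞 L) L) (MonoidHom.inr (InfiniteAdeleRing L) (FiniteAdeleRing (𝓞 L) L)) z)) →
    ∀ (v : HeightOneSpectrum (𝓞 ↥(maximalRealSubfield L))),
      (∀ w : PlacesOver L v, IsCMField.complexConj L • w.1 = w.1) →
      ∀ (T : GL (Fin 3) (LocalRing L v)) (a : LocalRing L v) (ha : IsUnit a)
        (h : formCongr (conjLocal L (IsCMField.complexConj L) v) T (H.map (algebraMap L (LocalRing L v))) =
          a • (Matrix.of fun i j : Fin 3 => if i.val + j.val + 1 = 3 then (1 : L) else 0).map (algebraMap L (LocalRing L v))),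
      ∀ [MeasurableSpace (Gqs L v ⧸ Subgroup.center (Gqs L v))] [BorelSpace (Gqs L v ⧸ Subgroup.center (Gqs L v))]
        (μZ : Measure (Gqs L v ⧸ Subgroup.center (Gqs L v))) [μZ.IsHaarMeasure],
      ∀ (π2 πn : IrrClass (Gqs L v)),
        KeysCaseTwoLabels L v (μω.semilocalComponent L v) (torusLocalComponent L (IsCMField.complexConj L) v ξ.η)
          (torusLocalComponent L (IsCMField.complexConj L) v ξ.ψ) π2 πn →
        ¬ πn.IsSquareIntegrable μZ →
        ∀ (πs : IrrClass ((cmDatum L 3 H).Local v)), πs.IsSupercuspidal →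
          πs ≠ IrrClass.comap (cmDatumLocalCongr L v T ha h).symm πn →
          (⟨IrrClass.comap (cmDatumLocalCongr L v T ha h).symm πn, some πs⟩ : CMLocalAPacket L H v).CharIdentityAtTest L H v
              (fun c f => c.smoothTrace (νG v) f) (ξloc v) (νH v) (Δ v) (mH v) (mG v) →
          ∃ ε : (↥(maximalRealSubfield L))ˣ, ThetaTypeAtCM L H e₁ dV hdV hdV0 g hg μ hμ χf ε v πs) :=
  Iff.rfl

/-- **MONOTONICITY — W1 IS WEAKER than print's clause**: the unrestricted ★ `CMThetaDockingClausesTest` implies `CMThetaDockingClausesTestW1` (drop the two extra hypotheses).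
[cite: Rogawski1990, §13.1 Prop. 13.1.4 p. 199] [cite: GelbartRogawski1991, Lem. 5.1.2 p. 466] -/
theorem cmThetaDockingClausesTest_toW1
    [∀ v : HeightOneSpectrum (𝓞 ↥(maximalRealSubfield L)), MeasurableSpace ((cmDatum L 3 H).Local v)]
    [∀ v : HeightOneSpectrum (𝓞 ↥(maximalRealSubfield L)),
      MeasurableSpace ((cmDatum L 2 (Matrix.of fun i j : Fin 2 => if i.val + j.val + 1 = 2 then (1 : L) else 0)).Local v ×
        (cmDatum L 1 (Matrix.of fun i j : Fin 1 => if i.val + j.val + 1 = 1 then (1 : L) else 0)).Local v)]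
    [∀ (v : HeightOneSpectrum (𝓞 ↥(maximalRealSubfield L)))
        (a : ((cmDatum L 2 (Matrix.of fun i j : Fin 2 => if i.val + j.val + 1 = 2 then (1 : L) else 0)).Local v ×
          (cmDatum L 1 (Matrix.of fun i j : Fin 1 => if i.val + j.val + 1 = 1 then (1 : L) else 0)).Local v)),
      MeasurableSpace (((cmDatum L 2 (Matrix.of fun i j : Fin 2 => if i.val + j.val + 1 = 2 then (1 : L) else 0)).Local v ×
          (cmDatum L 1 (Matrix.of fun i j : Fin 1 => if i.val + j.val + 1 = 1 then (1 : L) else 0)).Local v) ⧸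
        Subgroup.centralizer ({a} : Set ((cmDatum L 2 (Matrix.of fun i j : Fin 2 => if i.val + j.val + 1 = 2 then (1 : L) else 0)).Local v ×
          (cmDatum L 1 (Matrix.of fun i j : Fin 1 => if i.val + j.val + 1 = 1 then (1 : L) else 0)).Local v)))]
    [∀ (v : HeightOneSpectrum (𝓞 ↥(maximalRealSubfield L))) (γ : (cmDatum L 3 H).Local v),
      MeasurableSpace ((cmDatum L 3 H).Local v ⧸ Subgroup.centralizer ({γ} : Set ((cmDatum L 3 H).Local v)))]
    (Δ : ∀ v : HeightOneSpectrum (𝓞 ↥(maximalRealSubfield L)), LocalTransferFactor L H v)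
    (mH : ∀ v : HeightOneSpectrum (𝓞 ↥(maximalRealSubfield L)),
      OrbitalMeasureFamily ((cmDatum L 2 (Matrix.of fun i j : Fin 2 => if i.val + j.val + 1 = 2 then (1 : L) else 0)).Local v ×
        (cmDatum L 1 (Matrix.of fun i j : Fin 1 => if i.val + j.val + 1 = 1 then (1 : L) else 0)).Local v))
    (mG : ∀ v : HeightOneSpectrum (𝓞 ↥(maximalRealSubfield L)), OrbitalMeasureFamily ((cmDatum L 3 H).Local v))
    (νH : ∀ v : HeightOneSpectrum (𝓞 ↥(maximalRealSubfield L)),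
      Measure ((cmDatum L 2 (Matrix.of fun i j : Fin 2 => if i.val + j.val + 1 = 2 then (1 : L) else 0)).Local v ×
        (cmDatum L 1 (Matrix.of fun i j : Fin 1 => if i.val + j.val + 1 = 1 then (1 : L) else 0)).Local v))
    (νG : ∀ v : HeightOneSpectrum (𝓞 ↥(maximalRealSubfield L)), Measure ((cmDatum L 3 H).Local v))
    (ξ : OneDimAutRepH L) (μω : HeckeCharacter L)
    (ξloc : ∀ v : HeightOneSpectrum (𝓞 ↥(maximalRealSubfield L)),
      (cmDatum L 2 (Matrix.of fun i j : Fin 2 => if i.val + j.val + 1 = 2 then (1 : L) else 0)).Local v ×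
        (cmDatum L 1 (Matrix.of fun i j : Fin 1 => if i.val + j.val + 1 = 1 then (1 : L) else 0)).Local v →* ℂˣ)
    {n' : ℕ} (e₁ : Fin 3 × Fin 1 ≃ Fin n') (dV : Fin 3 → L) (hdV : ∀ i, IsCMField.complexConj L (dV i) = dV i) (hdV0 : ∀ i, dV i ≠ 0) (g : GL (Fin 3) L)
    (hg : ((g : Matrix (Fin 3) (Fin 3) L).map (cmConjRingHom L))ᵀ * H * (g : Matrix (Fin 3) (Fin 3) L) = Matrix.diagonal dV) :
    CMThetaDockingClausesTest L H Δ mH mG νH νG ξ μω ξloc e₁ dV hdV hdV0 g hg → CMThetaDockingClausesTestW1 L H Δ mH mG νH νG ξ μω ξloc e₁ dV hdV hdV0 g hg :=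
  fun h μ hμ χf hc hu _ _ => h μ hμ χf hc hu

end Clauses

end Literature.NumberTheory.Rogawski1990

end
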